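import Summits.CriticalPhenomena.SAWScalingLimit.Theorems.SAWSpinMonotoneQCIdentificationNoBranchingArcs
import Summits.CriticalPhenomena.SAWScalingLimit.Theorems.SAWSpinMonotoneQCIdentificationBoundaryPolar
import Summits.CriticalPhenomena.SAWScalingLimit.Theorems.SAWSpinMonotoneQCIdentificationStepLaw

/-!
# `NoBranching`, step S7 (a) — the real lift of the arc ledger (helper of
`stub_noBranching : NoFoldBound → NoBranching`, line `eight_fifths_primitive`, crux `QCIdentification`,
stmt-CriticalPhenomena-16772)

**What.** Let `F = Fobs Λ a` be the critical parafermionic observable of a simply connected domain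
`Λ` with boundary source `a`, under the no-fold bound (K) (`NoFoldBound`). For a boundary mid-edge
`p` of `Λ` all self-avoiding walks `a → p` have the same winding (rigidity,
`HexMidEdgeSAW.winding_eq_of_mem_boundary`); call it the **rigid boundary winding**
`W(p) = bdryWinding Λ a p` (with the convention `W(a) = 0`, and `0` if no walk exists). The
boundary polar form (S5, `NB.fobs_polar_of_mem_boundary`: `F(p) = Z_p e^{-i(5/8)W(p)}`, `Z_p > 0`;
`F(a) = 1`) gives `arg F(p) ≡ -(5/8) W(p) (mod 2π)` wherever `F(p) ≠ 0` (`arg_fobs_coe_bdryWinding`).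

Now fix an ARC at a site `s`: faces `face s (j+1), …, face s (j+m)` of `Λ` (`m ≠ 0`) with
non-degenerate `∂H`-modes, both flanks `face s j`, `face s (j+1+m)` outside `Λ`, flank mid-edges
`p_out = {face s j, face s (j+1)}`, `p_in = {face s (j+1+m), face s (j+m)}`. Then:

* the arc ledger modulo `2π` (S4, `NB.s4_arc_corner_sum_phase`) reads
  `B_arc ≡ m·π/3 + (5/8)(W(p_out) - W(p_in))`, `B_arc` the sum of the `m` corner angles at `s`;
* the boundary step law (S6, `StepLaw.sl_boundary_winding_step`, `…_src`) gives
  `W(p_out) - W(p_in) = π - m·π/3` if `a ∉ {p_out, p_in}` and `= -m·π/3` otherwise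
  (`bdryWinding_flank_sub`), so the representative `c = m·π/3 + (5/8)(W(p_out) - W(p_in))` lies in
  `(0, 2π)` (it is `5π/8 + m·π/8` or `m·π/8`, `1 ≤ m ≤ 5`);
* since `0 < B_arc` (`NB.s4_arc_corner_sum_mem`), the integer `n` in `B_arc = c + 2πn` is `≥ 0`:
  **the real lift** (registered `s7_arc_lift`)
  `B_arc = m·π/3 + (5/8)(W(p_out) - W(p_in)) + 2πn`, `n : ℕ`.

**Why.** Summed over all arcs of all boundary sites of the source component, the flank windings
telescope (`…NoBranchingTelescope`), so the total boundary angle excess `Σ (B_arc - m·π/3)` is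
`2π Σ n_arc ≥ 0`; with the face sum `Σ_v (Σ_k β_v(k) - π) = 0` this forces local degree one at every
interior hexagon (`…NoBranching`, the stub itself).

Sources: H. Duminil-Copin, S. Smirnov, *The connective constant of the honeycomb lattice equals
`√(2+√2)`*, Ann. of Math. 175 (2012) 1653–1665 (arXiv:1007.0575), §3 (boundary windings); the stub
report `STUB-REPORT-noBranching.md` of this line (§2, S5–S7).
-/

noncomputable section

open Complex
open Literature.Probability.LatticeModels Literature.Probability.RandomPlanarGeometry
open Literature.Probability.RandomPlanarGeometry.SAW
open Literature.Barriers.CriticalPhenomena Literature.Barriers.CriticalPhenomena.HexKernel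
open Summit.CriticalPhenomena.SAWScalingLimit.Theses.SAWDevelopingMap

namespace Summit.CriticalPhenomena.SAWScalingLimit.Cruxes.QCIdentification.EightFifthsPrimitive

namespace NB

/-! ### The rigid boundary winding -/

open Classical in
/-- The **rigid boundary winding** `W(p)` of the mid-edge `p` seen from the source `a`: the winding
of (any, by rigidity) self-avoiding walk `a → p`, with `W(a) = 0`, and `0` if there is no walk. -/
def bdryWinding (Λ : Finset HexVertex) (a p : Sym2 HexVertex) : ℝ :=
  if h : p ≠ a ∧ Nonempty (HexMidEdgeSAW Λ a p) then (Classical.choice h.2).winding else 0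

variable {Λ : Finset HexVertex} {a : Sym2 HexVertex}

/-- `W(a) = 0`. -/
theorem bdryWinding_self (Λ : Finset HexVertex) (a : Sym2 HexVertex) : bdryWinding Λ a a = 0 := by
  simp [bdryWinding]

/-- **Rigidity**: `W(p)` is the winding of every walk `a → p` to a boundary mid-edge `p ≠ a`. -/
theorem bdryWinding_eq_winding (hΛ : hexDomainSimplyConnected Λ) (ha : a ∈ hexDomainBoundary Λ)
    {p : Sym2 HexVertex} (hp : p ∈ hexDomainBoundary Λ) (hpa : p ≠ a) (γ : HexMidEdgeSAW Λ a p) :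
    bdryWinding Λ a p = γ.winding := by
  have h : p ≠ a ∧ Nonempty (HexMidEdgeSAW Λ a p) := ⟨hpa, ⟨γ⟩⟩
  rw [bdryWinding, dif_pos h]
  exact HexMidEdgeSAW.winding_eq_of_mem_boundary hΛ ha hp _ γ

/-- A non-zero value of the observable is carried by at least one walk. -/
theorem nonempty_saw_of_fobs_ne_zero {p : Sym2 HexVertex} (hF : Fobs Λ a p ≠ 0) :
    Nonempty (HexMidEdgeSAW Λ a p) := by
  by_contra h
  exact hF (fobs_eq_zero_of_isEmpty (not_nonempty_iff.1 h))

/-- **Boundary phases**: at a boundary mid-edge `p` with `F(p) ≠ 0`,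
`arg F(p) ≡ -(5/8) W(p) (mod 2π)` (`F(a) = 1` at the source; elsewhere the polar form
`F(p) = Z_p e^{-i(5/8)W}`, `Z_p > 0`). -/
theorem arg_fobs_coe_bdryWinding (hΛ : hexDomainSimplyConnected Λ) (ha : a ∈ hexDomainBoundary Λ)
    {p : Sym2 HexVertex} (hp : p ∈ hexDomainBoundary Λ) (hF : Fobs Λ a p ≠ 0) :
    (arg (Fobs Λ a p) : Real.Angle) = ((-(5 / 8 : ℝ) * bdryWinding Λ a p : ℝ) : Real.Angle) := by
  by_cases hpa : p = a
  · subst hpa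
    have h1 : Fobs Λ p p = 1 := hexParafermionicObservable_self hp _ _
    rw [bdryWinding_self, h1, Complex.arg_one, mul_zero]
  · obtain ⟨γ⟩ := nonempty_saw_of_fobs_ne_zero hF
    have hZ : 0 < genFun Λ a p := s5_genFun_pos Λ a p ⟨γ⟩
    rw [fobs_polar_of_mem_boundary hΛ ha hp γ, ← bdryWinding_eq_winding hΛ ha hp hpa γ,
      Complex.arg_real_mul _ hZ, HV.arg_exp_mul_I_coe]

/-! ### The flank windings of an arc -/

/-- **The flank winding difference of an arc** (the step law with the convention `W(a) = 0`): for an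
arc `face s (j+1), …, face s (j+m)` (`m ≠ 0`) of the hexagon around `s` in the simply connected `Λ`
with both flanks outside, and walks to the flank mid-edges other than `a`,
`W(p_out) - W(p_in) = π - m·π/3` if `a ∉ {p_out, p_in}`, and `= -m·π/3` if `a` is one of them. -/
theorem bdryWinding_flank_sub (hΛ : hexDomainSimplyConnected Λ) (ha : a ∈ hexDomainBoundary Λ)
    (s : Site 2) (j m : Fin 6) (hm : m ≠ 0) (hout : face s j ∉ Λ)
    (hin : ∀ i : Fin 6, i < m → face s (j + 1 + i) ∈ Λ) (hout' : face s (j + 1 + m) ∉ Λ)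
    (ho : s(face s j, face s (j + 1)) ≠ a → Nonempty (HexMidEdgeSAW Λ a s(face s j, face s (j + 1))))
    (hi : s(face s (j + 1 + m), face s (j + m)) ≠ a →
      Nonempty (HexMidEdgeSAW Λ a s(face s (j + 1 + m), face s (j + m)))) :
    bdryWinding Λ a s(face s j, face s (j + 1)) - bdryWinding Λ a s(face s (j + 1 + m), face s (j + m)) =
        Real.pi - (m : ℕ) * (Real.pi / 3) ∨
      bdryWinding Λ a s(face s j, face s (j + 1)) - bdryWinding Λ a s(face s (j + 1 + m), face s (j + m)) =
        -((m : ℕ) * (Real.pi / 3)) := by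
  obtain ⟨-, -, -, -, -, -, hbo, hbi⟩ := StepLaw.arc_setup s j m hm hout hin hout'
  have hne := StepLaw.flank_ne s j m hm
  by_cases h₁ : s(face s j, face s (j + 1)) = a
  · subst h₁
    right
    obtain ⟨γ'⟩ := hi hne.symm
    rw [bdryWinding_self, bdryWinding_eq_winding hΛ ha hbi hne.symm γ',
      StepLaw.boundary_winding_step_src_out hΛ s j m hm hout hin hout' γ']
    ring
  by_cases h₂ : s(face s (j + 1 + m), face s (j + m)) = a
  · subst h₂
    right
    obtain ⟨γ⟩ := ho hne
    rw [bdryWinding_self, bdryWinding_eq_winding hΛ ha hbo hne γ,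
      StepLaw.boundary_winding_step_src_in hΛ s j m hm hout hin hout' γ]
    ring
  · left
    obtain ⟨γ⟩ := ho h₁
    obtain ⟨γ'⟩ := hi h₂
    rw [bdryWinding_eq_winding hΛ ha hbo h₁ γ, bdryWinding_eq_winding hΛ ha hbi h₂ γ']
    exact StepLaw.sl_boundary_winding_step Λ hΛ a ha s j m hm hout hin hout' h₁ h₂ γ γ'

/-! ### The real lift of the arc ledger -/

/-- **The real lift of the arc ledger.** Under `NoFoldBound`, for an arc
`face s (j+1), …, face s (j+m)` (`m ≠ 0`) of faces of the simply connected `Λ` with non-degenerate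
`∂H`-modes and both flanks outside `Λ`, the sum of the `m` corner angles at `s` is EXACTLY
`m·π/3 + (5/8)(W(p_out) - W(p_in)) + 2πn` for a natural number `n`. -/
theorem arc_lift (hK : NoFoldBound) (hΛ : hexDomainSimplyConnected Λ) (ha : a ∈ hexDomainBoundary Λ)
    (s : Site 2) (j m : Fin 6) (hm : m ≠ 0) (hout : face s j ∉ Λ)
    (hin : ∀ i : Fin 6, i < m → face s (j + 1 + i) ∈ Λ) (hout' : face s (j + 1 + m) ∉ Λ)
    (hS : ∀ i : Fin 6, i < m → modeSum (Fobs Λ a) (face s (j + 1 + i)) ≠ 0) :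
    ∃ n : ℕ, ∑ i ∈ Finset.univ.filter (fun i : Fin 6 => i < m),
        cornerAngle (Fobs Λ a) (face s (j + 1 + i)) (arcCornerIdx (j + 1 + i)) =
      (m : ℕ) * (Real.pi / 3) + (5 / 8 : ℝ) * (bdryWinding Λ a s(face s j, face s (j + 1)) -
        bdryWinding Λ a s(face s (j + 1 + m), face s (j + m))) + 2 * Real.pi * n := by
  -- the flank values are non-zero (S1), hence carried by walks
  have h0 : (0 : Fin 6) < m := (Fin.pos_iff_ne_zero' m).2 hm
  have hl : m - 1 < m := Fin.sub_one_lt_iff.2 h0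
  have e : j + 1 + (m - 1) = j + m := by abel
  have hv0 : face s (j + 1) ∈ Λ := by simpa using hin 0 h0
  have hS0 : modeSum (Fobs Λ a) (face s (j + 1)) ≠ 0 := by simpa using hS 0 h0
  have hv1 : face s (j + m) ∈ Λ := by have h := hin (m - 1) hl; rwa [e] at h
  have hS1 : modeSum (Fobs Λ a) (face s (j + m)) ≠ 0 := by have h := hS (m - 1) hl; rwa [e] at h
  have hFo : Fobs Λ a s(face s j, face s (j + 1)) ≠ 0 := by
    have h := fobs_ne_zero_of_modeSum_ne_zero hK hΛ ha hv0 hS0 (arcCornerIdx (j + 1) + 1)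
    rwa [hexNbr_face_arcCornerIdx_succ, add_sub_cancel_right, Sym2.eq_swap] at h
  have hFi : Fobs Λ a s(face s (j + 1 + m), face s (j + m)) ≠ 0 := by
    have h := fobs_ne_zero_of_modeSum_ne_zero hK hΛ ha hv1 hS1 (arcCornerIdx (j + m))
    rwa [hexNbr_face_arcCornerIdx, show j + m + 1 = j + 1 + m by abel, Sym2.eq_swap] at h
  obtain ⟨n, hn4, hmval, -, -, -, hbo, hbi⟩ := StepLaw.arc_setup s j m hm hout hin hout'
  -- the ledger modulo `2π`, with the boundary phases substituted
  have hang := s4_arc_corner_sum_phase hK hΛ ha s j m hm hin hS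
  rw [arg_fobs_coe_bdryWinding hΛ ha hbo hFo, arg_fobs_coe_bdryWinding hΛ ha hbi hFi,
    ← Real.Angle.coe_sub, ← Real.Angle.coe_sub] at hang
  obtain ⟨k, hk⟩ := Real.Angle.angle_eq_iff_two_pi_dvd_sub.1 hang
  -- the real bounds
  have hB := (s4_arc_corner_sum_mem hK hΛ ha s j m hm hin hS).1
  have hD := bdryWinding_flank_sub hΛ ha s j m hm hout hin hout'
    (fun _ => nonempty_saw_of_fobs_ne_zero hFo) (fun _ => nonempty_saw_of_fobs_ne_zero hFi)
  set B := ∑ i ∈ Finset.univ.filter (fun i : Fin 6 => i < m),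
    cornerAngle (Fobs Λ a) (face s (j + 1 + i)) (arcCornerIdx (j + 1 + i)) with hBdef
  set D := bdryWinding Λ a s(face s j, face s (j + 1)) -
    bdryWinding Λ a s(face s (j + 1 + m), face s (j + m)) with hDdef
  have hπ := Real.pi_pos
  have hm1 : (1 : ℝ) ≤ ((m : ℕ) : ℝ) := by rw [hmval]; push_cast; linarith
  have hm5 : ((m : ℕ) : ℝ) ≤ 5 := by
    rw [hmval]
    have : (n : ℝ) ≤ 4 := by exact_mod_cast hn4
    push_cast; linarith
  -- `c = m π/3 + (5/8) D < 2π`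
  have hc : (m : ℕ) * (Real.pi / 3) + (5 / 8 : ℝ) * D < 2 * Real.pi := by
    rcases hD with h | h <;> rw [h] <;> nlinarith
  have hk' : B = (m : ℕ) * (Real.pi / 3) + (5 / 8 : ℝ) * D + 2 * Real.pi * k := by
    rw [← hk]; ring
  -- `k ≥ 0`
  have hk0 : (-1 : ℝ) < k := by
    by_contra hc'
    have : 2 * Real.pi * k ≤ 2 * Real.pi * (-1) :=
      mul_le_mul_of_nonneg_left (not_lt.1 hc') (by positivity)
    linarith
  have hk0' : (0 : ℤ) ≤ k := by
    have : (-1 : ℤ) < k := by exact_mod_cast hk0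
    omega
  obtain ⟨n', rfl⟩ := Int.eq_ofNat_of_zero_le hk0'
  exact ⟨n', by rw [hk']; push_cast; ring⟩

/-- **S7 (a), the real lift of the arc ledger (registered form).** Under `NoFoldBound`, in a simply
connected domain `Λ` with boundary source `a`, for an arc `face s (j+1), …, face s (j+m)` (`m ≠ 0`)
of faces of `Λ` with non-zero `∂H`-modes around a site `s`, both flanks `face s j`, `face s (j+1+m)`
outside `Λ`: the sum of the `m` corner angles at `s` equals
`m·π/3 + (5/8)(W(p_out) - W(p_in)) + 2πn` with `n : ℕ`, `W = bdryWinding Λ a` the rigid boundary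
winding, `p_out = {face s j, face s (j+1)}`, `p_in = {face s (j+1+m), face s (j+m)}`. -/
theorem s7_arc_lift : NoFoldBound → ∀ {Λ : Finset HexVertex}, hexDomainSimplyConnected Λ → ∀ {a : Sym2 HexVertex}, a ∈ hexDomainBoundary Λ → ∀ (s : Site 2) (j m : Fin 6), m ≠ 0 → HexKernel.face s j ∉ Λ → (∀ i : Fin 6, i < m → HexKernel.face s (j + 1 + i) ∈ Λ) → HexKernel.face s (j + 1 + m) ∉ Λ → (∀ i : Fin 6, i < m → modeSum (Fobs Λ a) (HexKernel.face s (j + 1 + i)) ≠ 0) → ∃ n : ℕ, ∑ i ∈ Finset.univ.filter (fun i : Fin 6 => i < m), cornerAngle (Fobs Λ a) (HexKernel.face s (j + 1 + i)) (arcCornerIdx (j + 1 + i)) = (m : ℕ) * (Real.pi / 3) + (5 / 8 : ℝ) * (bdryWinding Λ a s(HexKernel.face s j, HexKernel.face s (j + 1)) - bdryWinding Λ a s(HexKernel.face s (j + 1 + m), HexKernel.face s (j + m))) + 2 * Real.pi * n :=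
  fun hK _ hΛ _ ha s j m hm hout hin hout' hS => arc_lift hK hΛ ha s j m hm hout hin hout' hS

end NB

end Summit.CriticalPhenomena.SAWScalingLimit.Cruxes.QCIdentification.EightFifthsPrimitive

end
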